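import Literature.LinearAlgebra.Matrix.UnitaryThreeSlodowySliceDescent   -- ★ p852143 (F): `exists_slice_addEquiv`, `slice_injective`, θ-calculus
import Mathlib.Topology.Instances.Matrix
import Mathlib.Topology.Algebra.ContinuousMonoidHom
import HarnessLib

/-!
# The descended Slodowy chart `(Y, Z) ↦ 2·(N Y − Y N) + Z : (𝔲₀ ∩ range (ad N⁻)) × (𝔲₀ ∩ 𝔷(N⁻)) ≃ 𝔲₀` as a CONTINUOUS additive equivalence, with its EXPLICIT inverse

Topic `LinearAlgebra/Matrix`; namespace `Literature.LinearAlgebra.Matrix.UnitaryThreeSliceDescent` (continued).  THEOREMS ONLY (no definition ∕ instance ∕ notation ∕ named fact ∕ `sorry`).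
Sequel (D4d-F-top) to ★ `UnitaryThreeSlodowySliceDescent` for the analytic brick D5(iii) of the `hodgecm-mathlib` cell's ROAD «HC-D» (crux H413 = `stmt-HodgeConjecture-24833`;
count-neutral): the consumer (A-p12 (g29), file B2a) runs ★ `depth_chart_of_newtonData` on a `ContinuousAddEquiv`; here the `≃+` of ★ `exists_slice_addEquiv` is upgraded to
`≃ₜ+` for a topological field `K` (Pi topology on `Matrix`, subtype ∕ product topologies on the carriers), the inverse being CONTINUOUS because it is given by explicit
linear entry formulas.

* §1 `K`-LEVEL UNIQUENESS ∕ EXPLICIT SPLITTING (field, `2 ≠ 0`, `c ≠ 0`): `slice_injective_K` (shapes + `𝔷(E₂₀)` only, no skewness),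
  `slice_explicit_split` — for EVERY `X`: `X = 2 • (N Y_X − Y_X N) + W_X` with
  `W_X = !![2⁻¹(X₀₀+X₂₂), 0, 0; X₁₀, X₁₁, 0; X₂₀, X₂₁, 2⁻¹(X₀₀+X₂₂)] ∈ 𝔷(E₂₀)` and `Y_X = !![−(4c)⁻¹X₀₂, 0, 0; −(2c)⁻¹X₁₂, 0, 0; (4c)⁻¹(X₀₀−X₂₂), (2c)⁻¹X₀₁, (4c)⁻¹X₀₂]` of range shape.
* §2 (topological field): **`exists_slice_continuousAddEquiv`** — `∃ e : (↥Q × ↥C) ≃ₜ+ ↥𝔲₀` with `↑(e p) = 2 • (N ↑p.1 − ↑p.1 N) + ↑p.2`, `↑(e.symm X).1 = Y_X`, `↑(e.symm X).2 = W_X`.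

## References
* [Humphreys1972] J. E. Humphreys, *Introduction to Lie Algebras and Representation Theory* (1972), §7.2. Context locator (Slodowy, LNM 815 (1980) §7.4, in prose only).
* [Rogawski1990] J. D. Rogawski, *Automorphic Representations of Unitary Groups in Three Variables* (1990), §1.9 p. 8. Context locator.
-/

set_option autoImplicit false

open Matrix

namespace Literature.LinearAlgebra.Matrix.UnitaryThreeSliceDescent

/-! ## §1 `K`-level uniqueness and the explicit splitting -/

section KLevel

variable {K : Type*} [Field K]

/-- `K`-LEVEL UNIQUENESS of the slice decomposition: if `Y, Y′` have the range shape, `W, W′ ∈ 𝔷(E₂₀)` and `2•(NY − YN) + W = 2•(NY′ − Y′N) + W′` (`N = c·E₀₂`, `c ≠ 0`, `2 ≠ 0`)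
then `Y = Y′` and `W = W′` (★ (D) `bracket_eq_zero_of_commute_single_two_zero` + `eq_zero_of_mem_range_of_bracket_eq_zero`). [cite: Humphreys1972, §7.2] -/
theorem slice_injective_K (h2 : (2 : K) ≠ 0) {c : K} (hc0 : c ≠ 0) {Y Y' W W' : Matrix (Fin 3) (Fin 3) K}
    (hY : Y 0 1 = 0 ∧ Y 0 2 = 0 ∧ Y 1 1 = 0 ∧ Y 1 2 = 0 ∧ Y 0 0 + Y 2 2 = 0)
    (hY' : Y' 0 1 = 0 ∧ Y' 0 2 = 0 ∧ Y' 1 1 = 0 ∧ Y' 1 2 = 0 ∧ Y' 0 0 + Y' 2 2 = 0)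
    (hW : W * single (2 : Fin 3) (0 : Fin 3) (1 : K) = single (2 : Fin 3) (0 : Fin 3) 1 * W)
    (hW' : W' * single (2 : Fin 3) (0 : Fin 3) (1 : K) = single (2 : Fin 3) (0 : Fin 3) 1 * W')
    (h : (2 : K) • (single (0 : Fin 3) (2 : Fin 3) c * Y - Y * single (0 : Fin 3) (2 : Fin 3) c) + W =
      (2 : K) • (single (0 : Fin 3) (2 : Fin 3) c * Y' - Y' * single (0 : Fin 3) (2 : Fin 3) c) + W') :
    Y = Y' ∧ W = W' := by
  have h2u : IsUnit (2 : K) := isUnit_iff_ne_zero.mpr h2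
  have hcu : IsUnit c := isUnit_iff_ne_zero.mpr hc0
  obtain ⟨a1, a2, a3, a4, a5⟩ := hY
  obtain ⟨b1, b2, b3, b4, b5⟩ := hY'
  have hDshape : (Y - Y') 0 1 = 0 ∧ (Y - Y') 0 2 = 0 ∧ (Y - Y') 1 1 = 0 ∧ (Y - Y') 1 2 = 0 ∧ (Y - Y') 0 0 + (Y - Y') 2 2 = 0 := by
    refine ⟨?_, ?_, ?_, ?_, ?_⟩ <;> simp only [Matrix.sub_apply, a1, a2, a3, a4, b1, b2, b3, b4, sub_zero]
    linear_combination a5 - b5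
  have hWcomm : (W' - W) * single (2 : Fin 3) (0 : Fin 3) (1 : K) = single (2 : Fin 3) (0 : Fin 3) 1 * (W' - W) := by
    rw [sub_mul, mul_sub, hW, hW']
  have hAB : (2 : K) • (single (0 : Fin 3) (2 : Fin 3) c * Y - Y * single (0 : Fin 3) (2 : Fin 3) c) -
      (2 : K) • (single (0 : Fin 3) (2 : Fin 3) c * Y' - Y' * single (0 : Fin 3) (2 : Fin 3) c) = W' - W :=
    sub_eq_sub_iff_add_eq_add.mpr (h.trans (add_comm _ _))
  have hDW : (2 : K) • (single (0 : Fin 3) (2 : Fin 3) c * (Y - Y') - (Y - Y') * single (0 : Fin 3) (2 : Fin 3) c) = W' - W := by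
    rw [← hAB]
    simp only [sub_mul, mul_sub, smul_sub]
    abel
  have hbr : single (0 : Fin 3) (2 : Fin 3) c * (Y - Y') - (Y - Y') * single (0 : Fin 3) (2 : Fin 3) c = (2 : K)⁻¹ • (W' - W) := by
    rw [← hDW, smul_smul, inv_mul_cancel₀ h2, one_smul]
  have hcomm : (single (0 : Fin 3) (2 : Fin 3) c * (Y - Y') - (Y - Y') * single (0 : Fin 3) (2 : Fin 3) c) * single (2 : Fin 3) (0 : Fin 3) (1 : K) =
      single (2 : Fin 3) (0 : Fin 3) 1 * (single (0 : Fin 3) (2 : Fin 3) c * (Y - Y') - (Y - Y') * single (0 : Fin 3) (2 : Fin 3) c) := by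
    rw [hbr, Matrix.smul_mul, Matrix.mul_smul, hWcomm]
  have hzero := bracket_eq_zero_of_commute_single_two_zero h2u c (Y - Y') hcomm
  obtain ⟨s01, s02, s11, s12, str⟩ := hDshape
  have hD0 : Y - Y' = 0 := eq_zero_of_mem_range_of_bracket_eq_zero hcu h2u s01 s02 s11 s12 str hzero
  refine ⟨sub_eq_zero.mp hD0, ?_⟩
  have hW0 : W' - W = 0 := by rw [← hDW, hD0, Matrix.zero_mul, Matrix.mul_zero, sub_zero, smul_zero]
  exact (sub_eq_zero.mp hW0).symm

/-- THE EXPLICIT `𝔷(E₂₀)`-COMPONENT commutes with `E₂₀`. [cite: Humphreys1972, §7.2] -/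
theorem explicitW_comm (X : Matrix (Fin 3) (Fin 3) K) :
    !![(2 : K)⁻¹ * (X 0 0 + X 2 2), 0, 0; X 1 0, X 1 1, 0; X 2 0, X 2 1, (2 : K)⁻¹ * (X 0 0 + X 2 2)] * single (2 : Fin 3) (0 : Fin 3) (1 : K) =
      single (2 : Fin 3) (0 : Fin 3) 1 * !![(2 : K)⁻¹ * (X 0 0 + X 2 2), 0, 0; X 1 0, X 1 1, 0; X 2 0, X 2 1, (2 : K)⁻¹ * (X 0 0 + X 2 2)] := by
  rw [commute_single_two_zero_iff]
  simp

/-- THE EXPLICIT RANGE COMPONENT has the range shape. [cite: Humphreys1972, §7.2] -/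
theorem explicitY_shape (c : K) (X : Matrix (Fin 3) (Fin 3) K) :
    (!![-((4 * c)⁻¹ * X 0 2), 0, 0; -((2 * c)⁻¹ * X 1 2), 0, 0; (4 * c)⁻¹ * (X 0 0 - X 2 2), (2 * c)⁻¹ * X 0 1, (4 * c)⁻¹ * X 0 2] : Matrix (Fin 3) (Fin 3) K) 0 1 = 0 ∧
      (!![-((4 * c)⁻¹ * X 0 2), 0, 0; -((2 * c)⁻¹ * X 1 2), 0, 0; (4 * c)⁻¹ * (X 0 0 - X 2 2), (2 * c)⁻¹ * X 0 1, (4 * c)⁻¹ * X 0 2] : Matrix (Fin 3) (Fin 3) K) 0 2 = 0 ∧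
      (!![-((4 * c)⁻¹ * X 0 2), 0, 0; -((2 * c)⁻¹ * X 1 2), 0, 0; (4 * c)⁻¹ * (X 0 0 - X 2 2), (2 * c)⁻¹ * X 0 1, (4 * c)⁻¹ * X 0 2] : Matrix (Fin 3) (Fin 3) K) 1 1 = 0 ∧
      (!![-((4 * c)⁻¹ * X 0 2), 0, 0; -((2 * c)⁻¹ * X 1 2), 0, 0; (4 * c)⁻¹ * (X 0 0 - X 2 2), (2 * c)⁻¹ * X 0 1, (4 * c)⁻¹ * X 0 2] : Matrix (Fin 3) (Fin 3) K) 1 2 = 0 ∧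
      (!![-((4 * c)⁻¹ * X 0 2), 0, 0; -((2 * c)⁻¹ * X 1 2), 0, 0; (4 * c)⁻¹ * (X 0 0 - X 2 2), (2 * c)⁻¹ * X 0 1, (4 * c)⁻¹ * X 0 2] : Matrix (Fin 3) (Fin 3) K) 0 0 +
      (!![-((4 * c)⁻¹ * X 0 2), 0, 0; -((2 * c)⁻¹ * X 1 2), 0, 0; (4 * c)⁻¹ * (X 0 0 - X 2 2), (2 * c)⁻¹ * X 0 1, (4 * c)⁻¹ * X 0 2] : Matrix (Fin 3) (Fin 3) K) 2 2 = 0 := by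
  refine ⟨?_, ?_, ?_, ?_, ?_⟩ <;> simp

/-- **THE EXPLICIT SPLITTING** (`2 ≠ 0`, `c ≠ 0`): EVERY `X` is `2 • (N Y_X − Y_X N) + W_X` with the explicit `Y_X`, `W_X` above. [cite: Humphreys1972, §7.2] -/
theorem slice_explicit_split (h2 : (2 : K) ≠ 0) {c : K} (hc0 : c ≠ 0) (X : Matrix (Fin 3) (Fin 3) K) :
    X = (2 : K) • (single (0 : Fin 3) (2 : Fin 3) c *
        !![-((4 * c)⁻¹ * X 0 2), 0, 0; -((2 * c)⁻¹ * X 1 2), 0, 0; (4 * c)⁻¹ * (X 0 0 - X 2 2), (2 * c)⁻¹ * X 0 1, (4 * c)⁻¹ * X 0 2] -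
        !![-((4 * c)⁻¹ * X 0 2), 0, 0; -((2 * c)⁻¹ * X 1 2), 0, 0; (4 * c)⁻¹ * (X 0 0 - X 2 2), (2 * c)⁻¹ * X 0 1, (4 * c)⁻¹ * X 0 2] *
          single (0 : Fin 3) (2 : Fin 3) c) +
      !![(2 : K)⁻¹ * (X 0 0 + X 2 2), 0, 0; X 1 0, X 1 1, 0; X 2 0, X 2 1, (2 : K)⁻¹ * (X 0 0 + X 2 2)] := by
  have h4 : (4 : K) ≠ 0 := by
    have : (4 : K) = 2 * 2 := by norm_num
    rw [this]
    exact mul_ne_zero h2 h2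
  rw [single_zero_two_bracket_eq]
  ext i j
  fin_cases i <;> fin_cases j <;> simp <;> field_simp <;> ring

end KLevel

/-! ## §2 The continuous additive equivalence -/

section Topological

variable {K : Type*} [Field K] [TopologicalSpace K] [IsTopologicalRing K] (σ : K →+* K)
  (h2 : (2 : K) ≠ 0) {c : K} (hc : σ c = -c) (hc0 : c ≠ 0)
  (𝔲₀ Q C : AddSubgroup (Matrix (Fin 3) (Fin 3) K))
  (h𝔲₀ : ∀ X, X ∈ 𝔲₀ ↔ (X.map σ)ᵀ * !![(0 : K), 0, 1; 0, 1, 0; 1, 0, 0] + !![(0 : K), 0, 1; 0, 1, 0; 1, 0, 0] * X = 0 ∧ Matrix.trace X = 0)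
  (hQ : ∀ Y, Y ∈ Q ↔ Y ∈ 𝔲₀ ∧ (Y 0 1 = 0 ∧ Y 0 2 = 0 ∧ Y 1 1 = 0 ∧ Y 1 2 = 0 ∧ Y 0 0 + Y 2 2 = 0))
  (hC : ∀ Z, Z ∈ C ↔ Z ∈ 𝔲₀ ∧ Z * single (2 : Fin 3) (0 : Fin 3) (1 : K) = single (2 : Fin 3) (0 : Fin 3) 1 * Z)

include h2 hc hc0 h𝔲₀ hQ hC in
/-- **THE DESCENDED SLODOWY CHART AS `≃ₜ+`** with its explicit inverse: `↑(e p) = 2 • (N ↑p.1 − ↑p.1 N) + ↑p.2`, `↑(e.symm X).1 = Y_X`, `↑(e.symm X).2 = W_X`.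
[cite: Humphreys1972, §7.2] [cite: Rogawski1990, §1.9 p. 8] -/
theorem exists_slice_continuousAddEquiv :
    ∃ e : (↥Q × ↥C) ≃ₜ+ ↥𝔲₀,
      (∀ p : ↥Q × ↥C, ((e p : ↥𝔲₀) : Matrix (Fin 3) (Fin 3) K) =
        (2 : K) • (single (0 : Fin 3) (2 : Fin 3) c * (p.1 : Matrix (Fin 3) (Fin 3) K) - (p.1 : Matrix (Fin 3) (Fin 3) K) * single (0 : Fin 3) (2 : Fin 3) c) +
          (p.2 : Matrix (Fin 3) (Fin 3) K)) ∧
      (∀ X : ↥𝔲₀, ((e.symm X).1 : Matrix (Fin 3) (Fin 3) K) =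
        !![-((4 * c)⁻¹ * (X : Matrix (Fin 3) (Fin 3) K) 0 2), 0, 0; -((2 * c)⁻¹ * (X : Matrix (Fin 3) (Fin 3) K) 1 2), 0, 0;
           (4 * c)⁻¹ * ((X : Matrix (Fin 3) (Fin 3) K) 0 0 - (X : Matrix (Fin 3) (Fin 3) K) 2 2), (2 * c)⁻¹ * (X : Matrix (Fin 3) (Fin 3) K) 0 1,
           (4 * c)⁻¹ * (X : Matrix (Fin 3) (Fin 3) K) 0 2]) ∧
      (∀ X : ↥𝔲₀, ((e.symm X).2 : Matrix (Fin 3) (Fin 3) K) =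
        !![(2 : K)⁻¹ * ((X : Matrix (Fin 3) (Fin 3) K) 0 0 + (X : Matrix (Fin 3) (Fin 3) K) 2 2), 0, 0;
           (X : Matrix (Fin 3) (Fin 3) K) 1 0, (X : Matrix (Fin 3) (Fin 3) K) 1 1, 0;
           (X : Matrix (Fin 3) (Fin 3) K) 2 0, (X : Matrix (Fin 3) (Fin 3) K) 2 1, (2 : K)⁻¹ * ((X : Matrix (Fin 3) (Fin 3) K) 0 0 + (X : Matrix (Fin 3) (Fin 3) K) 2 2)]) := by
  obtain ⟨e₀, he₀⟩ := exists_slice_addEquiv σ h2 hc hc0 𝔲₀ Q C h𝔲₀ hQ hC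
  -- the inverse is the explicit splitting (K-level uniqueness)
  have hsymm : ∀ X : ↥𝔲₀,
      ((e₀.symm X).1 : Matrix (Fin 3) (Fin 3) K) =
        !![-((4 * c)⁻¹ * (X : Matrix (Fin 3) (Fin 3) K) 0 2), 0, 0; -((2 * c)⁻¹ * (X : Matrix (Fin 3) (Fin 3) K) 1 2), 0, 0;
           (4 * c)⁻¹ * ((X : Matrix (Fin 3) (Fin 3) K) 0 0 - (X : Matrix (Fin 3) (Fin 3) K) 2 2), (2 * c)⁻¹ * (X : Matrix (Fin 3) (Fin 3) K) 0 1,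
           (4 * c)⁻¹ * (X : Matrix (Fin 3) (Fin 3) K) 0 2] ∧
      ((e₀.symm X).2 : Matrix (Fin 3) (Fin 3) K) =
        !![(2 : K)⁻¹ * ((X : Matrix (Fin 3) (Fin 3) K) 0 0 + (X : Matrix (Fin 3) (Fin 3) K) 2 2), 0, 0;
           (X : Matrix (Fin 3) (Fin 3) K) 1 0, (X : Matrix (Fin 3) (Fin 3) K) 1 1, 0;
           (X : Matrix (Fin 3) (Fin 3) K) 2 0, (X : Matrix (Fin 3) (Fin 3) K) 2 1, (2 : K)⁻¹ * ((X : Matrix (Fin 3) (Fin 3) K) 0 0 + (X : Matrix (Fin 3) (Fin 3) K) 2 2)] := by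
    intro X
    have hp := he₀ (e₀.symm X)
    rw [AddEquiv.apply_symm_apply] at hp
    obtain ⟨-, hshape⟩ := (hQ _).mp (e₀.symm X).1.2
    obtain ⟨-, hcomm⟩ := (hC _).mp (e₀.symm X).2.2
    exact slice_injective_K h2 hc0 hshape (explicitY_shape c (X : Matrix (Fin 3) (Fin 3) K)) hcomm (explicitW_comm (X : Matrix (Fin 3) (Fin 3) K))
      (hp.symm.trans (slice_explicit_split h2 hc0 (X : Matrix (Fin 3) (Fin 3) K)))
  -- continuity of the entries of `↑X` on the subtype
  have hij : ∀ i j : Fin 3, Continuous fun X : ↥𝔲₀ => (X : Matrix (Fin 3) (Fin 3) K) i j := fun i j =>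
    (continuous_apply j).comp ((continuous_apply i).comp continuous_subtype_val)
  have hcont_to : Continuous e₀ := by
    refine continuous_induced_rng.2 ?_
    have hfun : (Subtype.val ∘ e₀ : ↥Q × ↥C → Matrix (Fin 3) (Fin 3) K) = fun p =>
        (2 : K) • (single (0 : Fin 3) (2 : Fin 3) c * (p.1 : Matrix (Fin 3) (Fin 3) K) - (p.1 : Matrix (Fin 3) (Fin 3) K) * single (0 : Fin 3) (2 : Fin 3) c) +
          (p.2 : Matrix (Fin 3) (Fin 3) K) := funext he₀
    rw [hfun]
    have h1 : Continuous fun p : ↥Q × ↥C => (p.1 : Matrix (Fin 3) (Fin 3) K) := continuous_subtype_val.comp continuous_fst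
    have h2' : Continuous fun p : ↥Q × ↥C => (p.2 : Matrix (Fin 3) (Fin 3) K) := continuous_subtype_val.comp continuous_snd
    exact (((continuous_const.matrix_mul h1).sub (h1.matrix_mul continuous_const)).const_smul (2 : K)).add h2'
  have hcont_inv : Continuous e₀.symm := by
    -- through the inducing map `↥Q × ↥C → Matrix × Matrix`
    have hind : Topology.IsInducing (fun q : ↥Q × ↥C => ((q.1 : Matrix (Fin 3) (Fin 3) K), (q.2 : Matrix (Fin 3) (Fin 3) K))) :=
      Topology.IsInducing.subtypeVal.prodMap Topology.IsInducing.subtypeVal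
    rw [hind.continuous_iff]
    have hfun : ((fun q : ↥Q × ↥C => ((q.1 : Matrix (Fin 3) (Fin 3) K), (q.2 : Matrix (Fin 3) (Fin 3) K))) ∘ e₀.symm) = fun X : ↥𝔲₀ =>
        ((!![-((4 * c)⁻¹ * (X : Matrix (Fin 3) (Fin 3) K) 0 2), 0, 0; -((2 * c)⁻¹ * (X : Matrix (Fin 3) (Fin 3) K) 1 2), 0, 0;
             (4 * c)⁻¹ * ((X : Matrix (Fin 3) (Fin 3) K) 0 0 - (X : Matrix (Fin 3) (Fin 3) K) 2 2), (2 * c)⁻¹ * (X : Matrix (Fin 3) (Fin 3) K) 0 1,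
             (4 * c)⁻¹ * (X : Matrix (Fin 3) (Fin 3) K) 0 2] : Matrix (Fin 3) (Fin 3) K),
         (!![(2 : K)⁻¹ * ((X : Matrix (Fin 3) (Fin 3) K) 0 0 + (X : Matrix (Fin 3) (Fin 3) K) 2 2), 0, 0;
             (X : Matrix (Fin 3) (Fin 3) K) 1 0, (X : Matrix (Fin 3) (Fin 3) K) 1 1, 0;
             (X : Matrix (Fin 3) (Fin 3) K) 2 0, (X : Matrix (Fin 3) (Fin 3) K) 2 1, (2 : K)⁻¹ * ((X : Matrix (Fin 3) (Fin 3) K) 0 0 + (X : Matrix (Fin 3) (Fin 3) K) 2 2)] :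
             Matrix (Fin 3) (Fin 3) K)) := by
      funext X
      exact Prod.ext (hsymm X).1 (hsymm X).2
    rw [hfun]
    refine Continuous.prodMk (continuous_matrix fun i j => ?_) (continuous_matrix fun i j => ?_) <;>
      fin_cases i <;> fin_cases j <;> simp <;>
      first
        | exact continuous_const
        | exact hij _ _
        | exact (continuous_const.mul (hij _ _)).neg
        | exact continuous_const.mul (hij _ _)
        | exact continuous_const.mul ((hij _ _).sub (hij _ _))
        | exact continuous_const.mul ((hij _ _).add (hij _ _))
  exact ⟨{ e₀ with continuous_toFun := hcont_to, continuous_invFun := hcont_inv }, he₀, fun X => (hsymm X).1, fun X => (hsymm X).2⟩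

end Topological

end Literature.LinearAlgebra.Matrix.UnitaryThreeSliceDescent
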